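import Summits.QuantumFields.YangMills.Theorems.BalabanUVNodesN13Cor3HistoryCountAtRecord13CoPH

/-!
# BalabanUVNodes ∕ N13 — THE k → k+1 STEP OF THE COR-3 UPPER LEAF (U1) AT NODE 00's STAGE-13 RECORD: MAJORANT TOWERS THROUGH def-T's `tstepOfRecord` AND def-R's
# `rstepSlotOfRecord`, THE (0.2)-CURRENCY PIECE STEP, AND F2's PER-HISTORY BINDER `hU1π` FROM PER-STEP ROWS (Track A, DAG node N13 = [B16]; cluster K1 — K1⁷
# `StabilityBAtRecordR13SepCoPH` = stmt-QuantumFields-20542, helper; seat `pub-ymgap-dag-n13-w3` g3, successor pointer (S1) of g2's HANDOFF = dag-lead g15's word I.28637; 2026-08-28; count-neutral)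

HONEST FRAMING.  Count-neutral kernel BOOKKEEPING + [folklore] measure-theoretic monotonicity of the one-step disintegration transport; nothing of Bałaban's is asserted.  g2 left the
UPPER HALF of (0.1) at K1⁷'s record priced by ONE displayed estimate: per last region (U1_Z) (F1 `densOfRecord₁₃_le_of_pieceBound`) or per history (U1π) (F2 `densOfRecord₁₃_le_of_historyBound`),
the counts (U2) being theorems.  THIS FILE CARVES THAT ESTIMATE ALONG THE SLOT RECURSION OF THE REPRESENTED TOWER OF RECORD (def-T FILE 2 `slotsOfRecord_succ` ∕ `slotsTOfRecord_succ`: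
`slot_{k+1} = 𝐑-step_{k+1} (𝐓-step_k slot_k)`, level 0 = `ρ₀`): it says, by name, WHICH PER-STEP FUNCTIONALS OF THE RECORD must carry the small factors.
(i) [folklore, PROVED] the transport of record `transportOfRecord` (def-T: `transportK` along `avOfRecord` = marginal density × conditional law) is DOMINATED: `|h| ≤ H` pointwise with `H`
bounded measurable ⟹ `|T h| ≤ T H` pointwise, and `T (c·f) = c·T f` (§1).  (ii) [PROVED] ONE STEP: if the level-`k` history term `χ_k(s)·slot_k(s)` has a bounded measurable field-dependent
majorant `M(s)`, then `|χ_{k+1}(s′)·slot_{k+1}(s′)(V′)| ≤ χ_{k+1}(s′)(V′) · c_R(s′) · T_k(|w_k(s′)(·,V′)|·M(init s′))(V′)` — the TRANSPORTED, STEP-WEIGHTED old majorant times the modulus `c_R` of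
the 𝐑-step's ratio factor ([IV] (0.3): `slot_{k+1} = slotT_{k+1} · Σ ratios`, displayed as the row `|slot_{k+1}| ≤ c_R·|slotT_{k+1}|`) (§2).  (iii) [PROVED] THE TOWER: a family of majorants
`M_j` with the STEP ROWS `χ_{j+1} c_R T_j(|w_j| M_j ∘ init) ≤ M_{j+1}` (`j < k`) bounds every level-`k` history term, the BASE being DISCHARGED — `M_0 ⊇ ρ₀ = e^{−E}·(Wilson–Boltzmann weight)`
(`rhoZeroOfRecord_le`, `χ_0 ≡ 1`), which is where print's large-plaquette suppression `e^{−p₀(g₀)}` ([IV] (0.1) p.175) lives (§2).  (iv) [PROVED] THE (0.2)-CURRENCY STEP: the level-(k+1)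
piece `ρ_{k+1}(Z′,·)` (def-R `pieceOfRecord`) is bounded by the sum over the histories `s′` with `Λ_{k+1}(s′)ᶜ = Z′` of the same transported functional (§2).  (v) AT K1⁷'s RECORD (§3): the
`w`-measurability ∕ `|w| ≤ 1` rows are def-T's `TStepProvisos` FROM `Provisos₁₃CoPH` (`h.tstep`), so the tower needs only the 𝐑-ratio row and the step rows; in the PRODUCT SHAPE
`M_j(s) = e^{a_j} Π_{i≤j} x_i^{#⊄Ω_i(s)} y_i^{#⊄Λ_i(s)}` the step rows read «`χ_{j+1}(s′)(V′)·c_R(s′)·T_j(|w_j(s′)(·,V′)|)(V′)·e^{a_j} ≤ e^{a_{j+1}}·x_{j+1}^{#⊄Ω_{j+1}(s′)}·y_{j+1}^{#⊄Λ_{j+1}(s′)}`» and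
yield F2's binder `hU1π` VERBATIM (★★★ `histBound₁₃_of_productStepRows`), hence `ρ_k ≤ exp(E₊|T₁^{(k)}|)` (★★★ `densOfRecord₁₃_le_of_productStepRows`, F2's count + numeric clause).
WHAT IS DISPLAYED, AND WHERE PRINT PUTS THE SMALL FACTORS (LOCATED, nobody's theorem here): the step rows and the 𝐑-ratio row ARE Bałaban's [III] §3 ∕ [IV] §1 ∕ [B16] §1 analysis — in print
the factor per NEW large-field cube comes from the action `e^{A_j}` on that cube (the first term of (2.49) [III] p.264, «yields the small factors for large field characteristic functions»;
the 𝐓-operation bound (1.89) [B16] p.387), i.e. through a FIELD-DEPENDENT majorant `M_j` (§2's general tower), not through the step weights alone; the product-shape rows of §3 are the SHAPE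
in which F2's `hU1π` is met, with `x_{j+1} = y_{j+1} = 1` the plain sup-currency instance.  (U1) NOT proved; [III] Cor. 3 NOT proved; N13 NOT discharged; K0⁷ ∕ K1⁷ NOT closed; counts unmoved
(discharged 5∕27 · Track A 5∕28).  ONE finite four-torus programme at fixed `ε = L^{−K}`; R4 closes the conditional finite-𝕋⁴ rung `BalabanLadder.UV` only — the Yang–Mills mass gap (Clay) is
NOT proved by any of this; nothing continuum ∕ ℝ⁴ ∕ OS.  No `sorry`, `def`, `instance`, `notation`.

Sources: [Balaban1988Convergent] (2.18) p.257, (2.49) + Cor. 3 (2.50) p.264, (3.1) p.264, (3.24)–(3.25) p.270; [Balaban1989LargeFieldI] (0.1) p.175, (0.2)–(0.4) p.176;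
[Balaban1989LargeFieldII] Thm 1 + (0.1) pp.355–356, (1.89) p.387.
-/

noncomputable section

open MeasureTheory
open scoped BigOperators

namespace Summit.QuantumFields.YangMills.BalabanUVNodes.N13U1StepMajorantTowerAtRecord13CoPH

open Literature.MathematicalPhysics.QuantumFieldTheory.Balaban1983to89
open T4Continuum Node00 B14.Eq218Concrete
open T4AveragingDisintegration (transportK kernelTransport avgKernel)
open Summit.QuantumFields.YangMills.BalabanUVNodes.N13Cor3HistoryCountAtRecord13CoPH (densOfRecord₁₃_le_of_historyBound)

/-! ## §1. The one-step transport of record is dominated and homogeneous [folklore] -/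

section Transport

variable (F : T4Family) (N : ℕ) [NeZero N]

/-- **DOMINATION OF THE TRANSPORT OF RECORD** [folklore]: def-T's `transportOfRecord K k` (`= transportK` along `avOfRecord`, i.e. marginal density × the integral against the conditional law of
the fine field, a probability measure) satisfies `|T h (V′)| ≤ T H (V′)` whenever `|h| ≤ H` pointwise and `H` is bounded measurable (so that `H` is integrable against the conditional law;
no integrability of `h` is needed: `|∫h| ≤ ∫|h| ≤ ∫H`). [cite: Balaban1988Convergent, (3.1) p.264 (bookkeeping: the δ-function integral read as the tree's disintegration kernel)] -/
theorem abs_transportOfRecord_le (K k : ℕ) {h H : GaugeField (F.P K) k (SU N) → ℝ} (hle : ∀ U, |h U| ≤ H U)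
    (hHm : Measurable H) {C : ℝ} (hHC : ∀ U, H U ≤ C) (V' : GaugeField (F.P K) (k + 1) (SU N)) :
    |transportOfRecord F N K k h V'| ≤ transportOfRecord F N K k H V' := by
  simp only [transportOfRecord, transportK, kernelTransport]
  have hH0 : ∀ U, 0 ≤ H U := fun U => (abs_nonneg _).trans (hle U)
  have hHi : Integrable H (avgKernel (avOfRecord F N K k).avg V') :=
    Integrable.of_bound hHm.aestronglyMeasurable C
      (ae_of_all _ fun U => by rw [Real.norm_eq_abs, abs_of_nonneg (hH0 U)]; exact hHC U)
  have h1 : |∫ U, h U ∂(avgKernel (avOfRecord F N K k).avg V')| ≤ ∫ U, H U ∂(avgKernel (avOfRecord F N K k).avg V') :=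
    (abs_integral_le_integral_abs).trans
      (integral_mono_of_nonneg (ae_of_all _ fun U => abs_nonneg _) hHi (ae_of_all _ hle))
  rw [abs_mul, abs_of_nonneg (NNReal.coe_nonneg _)]
  exact mul_le_mul_of_nonneg_left h1 (NNReal.coe_nonneg _)

/-- The transport of record is homogeneous: `T (c·f) = c · T f` [folklore]. [cite: Balaban1988Convergent, (3.1) p.264 (bookkeeping)] -/
theorem transportOfRecord_const_mul (K k : ℕ) (c : ℝ) (f : GaugeField (F.P K) k (SU N) → ℝ) (V' : GaugeField (F.P K) (k + 1) (SU N)) :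
    transportOfRecord F N K k (fun U => c * f U) V' = c * transportOfRecord F N K k f V' := by
  simp only [transportOfRecord, transportK, kernelTransport]
  rw [integral_const_mul]
  ring

end Transport

/-! ## §2. GENERIC OVER THE REPRESENTED TOWER OF RECORD: the base, ONE STEP, THE TOWER, and the (0.2)-currency piece step -/

section Tower

variable (F : T4Family) (N : ℕ) [NeZero N] (ν : Stage7Numerics) (τ : TowerNumerics)
variable (E : B12.RunParams → ℝ) (w : StepWeightsOfRecord F N ν τ.M) (ppSel : PpSelOfRecord F ν τ.M) (p : B12.RunParams) (g : ℕ → ℝ)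

/-- **THE BASE**: at level 0 the history term IS `ρ₀` — `χ_0 ≡ 1` (def-T `chiSeqOfRecord_zero`) and `slot_0 = rhoZeroOfRecord` (`texpAOfRecord_zero`), which is positive.
[cite: Balaban1988Convergent, Thm 1 p.262, (2.18) p.257 (bookkeeping)] -/
theorem abs_histTerm_zero_eq (s : SeqOfRecord F ν τ.M g p.K 0) (U : GaugeField (F.P p.K) 0 (SU N)) :
    |chiSeqOfRecord F N ν τ.M g p.K 0 s U * slotsOfRecord F N ν τ E w ppSel p g 0 s U| = rhoZeroOfRecord F N p.K (g 0) (E p) U := by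
  rw [chiSeqOfRecord_zero, one_mul]
  unfold slotsOfRecord
  rw [texpAOfRecord_zero]
  exact abs_of_pos (rhoZeroOfRecord_pos F N p.K (g 0) (E p) U)

/-- The base majorant is DISCHARGED in sup currency: `|χ_0(s)·slot_0(s)(U)| = ρ₀(U) ≤ e^{−E(p)}` (`rhoZeroOfRecord_le`: the Wilson–Boltzmann weight is `≤ 1`).
[cite: Balaban1988Convergent, Thm 1 p.262 (bookkeeping); Balaban1989LargeFieldI, (0.1) p.175 (the level-0 large-plaquette suppression lives in this weight)] -/
theorem abs_histTerm_zero_le_exp (s : SeqOfRecord F ν τ.M g p.K 0) (U : GaugeField (F.P p.K) 0 (SU N)) :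
    |chiSeqOfRecord F N ν τ.M g p.K 0 s U * slotsOfRecord F N ν τ E w ppSel p g 0 s U| ≤ Real.exp (-E p) := by
  rw [abs_histTerm_zero_eq]
  exact rhoZeroOfRecord_le F N p.K (g 0) (E p) U

/-- **★★ ONE STEP `k → k+1` OF THE UPPER LEAF, THROUGH `tstepOfRecord` AND `rstepSlotOfRecord`** [PROVED]: if the level-`k` history term at `init s′` has a bounded measurable (field-dependent)
majorant `M`, the step weight `w_k(s′)(·,V′)` is measurable with `|w| ≤ 1` (def-T's `TStepProvisos.measW ∕ absW_le`), and the 𝐑-step of record multiplies the pre-𝐑 slot by a factor of modulus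
`≤ c_R` (displayed row: [IV] (0.3) «`(𝐓e^A)′(s′) = (𝐓e^A)(s′)·Σ ratios`», def-R `rstepOfSel_TexpA`), then
`|χ_{k+1}(s′)(V′)·slot_{k+1}(s′)(V′)| ≤ χ_{k+1}(s′)(V′) · c_R · T_k(|w_k(s′)(·,V′)| · M)(V′)` — the transported, step-weighted old majorant (`slotsTOfRecord_succ`, `tstepOfRecord_apply`, §1).
Nothing of Bałaban's asserted. [cite: Balaban1988Convergent, (3.1) p.264, (3.24)–(3.25) p.270; Balaban1989LargeFieldI, (0.3) p.176] -/
theorem abs_histTerm_succ_le (k : ℕ) (s' : SeqOfRecord F ν τ.M g p.K (k + 1)) (V' : GaugeField (F.P p.K) (k + 1) (SU N))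
    {M : GaugeField (F.P p.K) k (SU N) → ℝ}
    (hM : ∀ U, |chiSeqOfRecord F N ν τ.M g p.K k s'.init U * slotsOfRecord F N ν τ E w ppSel p g k s'.init U| ≤ M U)
    (hMm : Measurable M) {C : ℝ} (hMC : ∀ U, M U ≤ C)
    (hw : Measurable fun U : GaugeField (F.P p.K) k (SU N) => w p g k s' U V') (hwb : ∀ U, |w p g k s' U V'| ≤ 1)
    {cR : ℝ} (hcR : 0 ≤ cR)
    (hR : |slotsOfRecord F N ν τ E w ppSel p g (k + 1) s' V'| ≤ cR * |slotsTOfRecord F N ν τ E w ppSel p g (k + 1) s' V'|) :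
    |chiSeqOfRecord F N ν τ.M g p.K (k + 1) s' V' * slotsOfRecord F N ν τ E w ppSel p g (k + 1) s' V'|
      ≤ chiSeqOfRecord F N ν τ.M g p.K (k + 1) s' V' * cR *
        transportOfRecord F N p.K k (fun U => |w p g k s' U V'| * M U) V' := by
  have hχ0 := chiSeqOfRecord_nonneg F N ν τ.M g p.K (k + 1) s' V'
  have hM0 : ∀ U, 0 ≤ M U := fun U => (abs_nonneg _).trans (hM U)
  have hT : |slotsTOfRecord F N ν τ E w ppSel p g (k + 1) s' V'|
      ≤ transportOfRecord F N p.K k (fun U => |w p g k s' U V'| * M U) V' := by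
    rw [slotsTOfRecord_succ, tstepOfRecord_apply]
    refine abs_transportOfRecord_le F N p.K k (fun U => ?_) ((continuous_abs.measurable.comp hw).mul hMm) (C := C) (fun U => ?_) V'
    · rw [abs_mul]
      exact mul_le_mul_of_nonneg_left (hM U) (abs_nonneg _)
    · calc |w p g k s' U V'| * M U ≤ 1 * M U := mul_le_mul_of_nonneg_right (hwb U) (hM0 U)
        _ ≤ C := by rw [one_mul]; exact hMC U
  calc |chiSeqOfRecord F N ν τ.M g p.K (k + 1) s' V' * slotsOfRecord F N ν τ E w ppSel p g (k + 1) s' V'|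
      = chiSeqOfRecord F N ν τ.M g p.K (k + 1) s' V' * |slotsOfRecord F N ν τ E w ppSel p g (k + 1) s' V'| := by
        rw [abs_mul, abs_of_nonneg hχ0]
    _ ≤ chiSeqOfRecord F N ν τ.M g p.K (k + 1) s' V' * (cR * transportOfRecord F N p.K k (fun U => |w p g k s' U V'| * M U) V') :=
        mul_le_mul_of_nonneg_left (hR.trans (mul_le_mul_of_nonneg_left hT hcR)) hχ0
    _ = _ := by ring

/-- **★★★ THE MAJORANT TOWER** [PROVED]: a family of field-dependent majorants `M_j(s)` (measurable, bounded) with the BASE `ρ₀ ≤ M_0` and, for every `j < k`, the 𝐑-ratio row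
`|slot_{j+1}| ≤ c_R(s′)·|slotT_{j+1}|` (`c_R ≥ 0`) and the STEP ROW `χ_{j+1}(s′)(V′)·c_R(s′)·T_j(|w_j(s′)(·,V′)|·M_j(init s′))(V′) ≤ M_{j+1}(s′)(V′)` bounds every level-`k` history term:
`|χ_k(s)(U)·slot_k(s)(U)| ≤ M_k(s)(U)`.  The step rows and the 𝐑-ratio row are the DISPLAYED analytic content ([III] §3 ∕ (2.49), [IV] §1, [B16] (1.89)) — nobody's theorem here; print meets
them with a field-dependent `M_j` carrying the action's large-field suppression on the new cubes. [cite: Balaban1988Convergent, (2.49) p.264, (3.25) p.270; Balaban1989LargeFieldI, (0.3) p.176; Balaban1989LargeFieldII, (1.89) p.387] -/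
theorem abs_histTerm_le_of_majorantTower (k : ℕ)
    (M : (j : ℕ) → SeqOfRecord F ν τ.M g p.K j → GaugeField (F.P p.K) j (SU N) → ℝ)
    (cR : (j : ℕ) → SeqOfRecord F ν τ.M g p.K j → GaugeField (F.P p.K) j (SU N) → ℝ)
    (h0 : ∀ (s : SeqOfRecord F ν τ.M g p.K 0) U, rhoZeroOfRecord F N p.K (g 0) (E p) U ≤ M 0 s U)
    (hMm : ∀ j, j < k → ∀ s, Measurable (M j s))
    (hMC : ∀ j, j < k → ∀ s, ∃ C : ℝ, ∀ U, M j s U ≤ C)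
    (hw : ∀ j, j < k → ∀ (s' : SeqOfRecord F ν τ.M g p.K (j + 1)) (V' : GaugeField (F.P p.K) (j + 1) (SU N)),
      Measurable fun U : GaugeField (F.P p.K) j (SU N) => w p g j s' U V')
    (hwb : ∀ j, j < k → ∀ (s' : SeqOfRecord F ν τ.M g p.K (j + 1)) U V', |w p g j s' U V'| ≤ 1)
    (hcR : ∀ j, j < k → ∀ (s' : SeqOfRecord F ν τ.M g p.K (j + 1)) V', 0 ≤ cR (j + 1) s' V')
    (hR : ∀ j, j < k → ∀ (s' : SeqOfRecord F ν τ.M g p.K (j + 1)) V',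
      |slotsOfRecord F N ν τ E w ppSel p g (j + 1) s' V'| ≤ cR (j + 1) s' V' * |slotsTOfRecord F N ν τ E w ppSel p g (j + 1) s' V'|)
    (hstep : ∀ j, j < k → ∀ (s' : SeqOfRecord F ν τ.M g p.K (j + 1)) V',
      chiSeqOfRecord F N ν τ.M g p.K (j + 1) s' V' * cR (j + 1) s' V' *
        transportOfRecord F N p.K j (fun U => |w p g j s' U V'| * M j s'.init U) V' ≤ M (j + 1) s' V') :
    ∀ (s : SeqOfRecord F ν τ.M g p.K k) U,
      |chiSeqOfRecord F N ν τ.M g p.K k s U * slotsOfRecord F N ν τ E w ppSel p g k s U| ≤ M k s U := by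
  induction k with
  | zero =>
    intro s U
    rw [abs_histTerm_zero_eq]
    exact h0 s U
  | succ k ih =>
    intro s' V'
    have ih' := ih (fun j hj => hMm j (by omega)) (fun j hj => hMC j (by omega)) (fun j hj => hw j (by omega))
      (fun j hj => hwb j (by omega)) (fun j hj => hcR j (by omega)) (fun j hj => hR j (by omega)) (fun j hj => hstep j (by omega))
    obtain ⟨C, hC⟩ := hMC k (lt_add_one k) s'.init
    exact (abs_histTerm_succ_le F N ν τ E w ppSel p g k s' V' (ih' s'.init) (hMm k (lt_add_one k) s'.init) hC
      (hw k (lt_add_one k) s' V') (fun U => hwb k (lt_add_one k) s' U V') (hcR k (lt_add_one k) s' V')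
      (hR k (lt_add_one k) s' V')).trans (hstep k (lt_add_one k) s' V')

open Classical in
/-- **★★ THE (0.2)-CURRENCY STEP** [PROVED] ([IV] (0.2) «`ρ(V) = Σ_Z ρ(Z, V)`», def-R `pieceOfRecord` at the post-𝐑 slots): the level-(k+1) piece with last large-field region `Z′` is bounded by
the sum, over the level-(k+1) histories `s′` with `Λ_{k+1}(s′)ᶜ = Z′`, of the transported step-weighted level-`k` majorant times the 𝐑-ratio modulus:
`|ρ_{k+1}(Z′, V′)| ≤ Σ_{s′ : Λ_{k+1}(s′)ᶜ = Z′} χ_{k+1}(s′)(V′)·c_R(s′)·T_k(|w_k(s′)(·,V′)|·M(init s′))(V′)` — these summands are the per-step integrals that must carry the new step's small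
factors for (U1_Z) to propagate (F1 `densOfRecord₁₃_le_of_pieceBound` is the consumer).  Nothing of Bałaban's asserted. [cite: Balaban1989LargeFieldI, (0.2)–(0.3) p.176; Balaban1988Convergent, (3.1) p.264] -/
theorem abs_pieceOfRecord_succ_le (k : ℕ) (Z' : Set (Site (F.P p.K) 0)) (V' : GaugeField (F.P p.K) (k + 1) (SU N))
    (M : SeqOfRecord F ν τ.M g p.K k → GaugeField (F.P p.K) k (SU N) → ℝ)
    (cR : SeqOfRecord F ν τ.M g p.K (k + 1) → GaugeField (F.P p.K) (k + 1) (SU N) → ℝ)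
    (hM : ∀ s U, |chiSeqOfRecord F N ν τ.M g p.K k s U * slotsOfRecord F N ν τ E w ppSel p g k s U| ≤ M s U)
    (hMm : ∀ s, Measurable (M s)) (hMC : ∀ s, ∃ C : ℝ, ∀ U, M s U ≤ C)
    (hw : ∀ s' : SeqOfRecord F ν τ.M g p.K (k + 1), Measurable fun U : GaugeField (F.P p.K) k (SU N) => w p g k s' U V')
    (hwb : ∀ (s' : SeqOfRecord F ν τ.M g p.K (k + 1)) U, |w p g k s' U V'| ≤ 1)
    (hcR : ∀ s', 0 ≤ cR s' V')
    (hR : ∀ s', |slotsOfRecord F N ν τ E w ppSel p g (k + 1) s' V'| ≤ cR s' V' * |slotsTOfRecord F N ν τ E w ppSel p g (k + 1) s' V'|) :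
    |pieceOfRecord F N ν τ.M (slotsOfRecord F N ν τ E w ppSel) p g (k + 1) Z' V'|
      ≤ ∑ s' ∈ Finset.univ.filter (fun s' : SeqOfRecord F ν τ.M g p.K (k + 1) => (s'.Λ (k + 1))ᶜ = Z'),
          chiSeqOfRecord F N ν τ.M g p.K (k + 1) s' V' * cR s' V' *
            transportOfRecord F N p.K k (fun U => |w p g k s' U V'| * M s'.init U) V' := by
  unfold pieceOfRecord
  refine (Finset.abs_sum_le_sum_abs _ _).trans (Finset.sum_le_sum fun s' _ => ?_)
  obtain ⟨C, hC⟩ := hMC s'.init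
  exact abs_histTerm_succ_le F N ν τ E w ppSel p g k s' V' (hM s'.init) (hMm s'.init) hC (hw s') (hwb s') (hcR s') (hR s')

end Tower

/-! ## §3. AT K1⁷'s RECORD: the `w`-rows from `Provisos₁₃CoPH`, the tower, the product shape = F2's `hU1π`, and the upper half of (0.1) -/

section AtRecord

variable (F : T4Family) (N : ℕ) [NeZero N]
variable (θ : Stage13HParams F N) (P : B12.RunParams)

/-- **★★★ THE MAJORANT TOWER AT THE STAGE-13 RECORD** (K1⁷'s letters): along the run `P` with its ₁₃ history, def-T's step provisos FROM `Provisos₁₃CoPH` (`h.tstep`: `measW`, `absW_le`) discharge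
the `w`-rows of `abs_histTerm_le_of_majorantTower`, so every level-`k` history term of `densOfRecord₁₃` (`k ≤ K`) is bounded by `M_k` from: the base `ρ₀ ≤ M_0`, the 𝐑-ratio rows and the
step rows (DISPLAYED; LOCATED as [III] §3 ∕ [IV] §1 ∕ [B16] (1.89)).  Nothing of Bałaban's asserted. [cite: Balaban1988Convergent, (3.25) p.270, (2.49) p.264; Balaban1989LargeFieldI, (0.3) p.176; Balaban1989LargeFieldII, (1.89) p.387] -/
theorem abs_histTerm₁₃_le_of_majorantTower (h : θ.Provisos₁₃CoPH F N) (k : ℕ) (hk : k ≤ P.K)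
    (M : (j : ℕ) → SeqOfRecord F θ.ν θ.τ9.M (gOfRecord₁₃ F N θ.toStage13Params P) P.K j → GaugeField (F.P P.K) j (SU N) → ℝ)
    (cR : (j : ℕ) → SeqOfRecord F θ.ν θ.τ9.M (gOfRecord₁₃ F N θ.toStage13Params P) P.K j → GaugeField (F.P P.K) j (SU N) → ℝ)
    (h0 : ∀ (s : SeqOfRecord F θ.ν θ.τ9.M (gOfRecord₁₃ F N θ.toStage13Params P) P.K 0) U,
      rhoZeroOfRecord F N P.K (gOfRecord₁₃ F N θ.toStage13Params P 0) (EOfRecord₁₃ F N θ.toStage13Params P) U ≤ M 0 s U)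
    (hMm : ∀ j, j < k → ∀ s, Measurable (M j s))
    (hMC : ∀ j, j < k → ∀ s, ∃ C : ℝ, ∀ U, M j s U ≤ C)
    (hcR : ∀ j, j < k → ∀ (s' : SeqOfRecord F θ.ν θ.τ9.M (gOfRecord₁₃ F N θ.toStage13Params P) P.K (j + 1)) V', 0 ≤ cR (j + 1) s' V')
    (hR : ∀ j, j < k → ∀ (s' : SeqOfRecord F θ.ν θ.τ9.M (gOfRecord₁₃ F N θ.toStage13Params P) P.K (j + 1)) V',
      |slotsOfRecord F N θ.ν θ.τ9 (EOfRecord₁₃ F N θ.toStage13Params) (wOfRecord₉ F N θ.toStage9Params) θ.ppSel P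
          (gOfRecord₁₃ F N θ.toStage13Params P) (j + 1) s' V'| ≤
        cR (j + 1) s' V' * |slotsTOfRecord F N θ.ν θ.τ9 (EOfRecord₁₃ F N θ.toStage13Params) (wOfRecord₉ F N θ.toStage9Params) θ.ppSel P
          (gOfRecord₁₃ F N θ.toStage13Params P) (j + 1) s' V'|)
    (hstep : ∀ j, j < k → ∀ (s' : SeqOfRecord F θ.ν θ.τ9.M (gOfRecord₁₃ F N θ.toStage13Params P) P.K (j + 1)) V',
      chiSeqOfRecord F N θ.ν θ.τ9.M (gOfRecord₁₃ F N θ.toStage13Params P) P.K (j + 1) s' V' * cR (j + 1) s' V' *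
        transportOfRecord F N P.K j (fun U => |wOfRecord₉ F N θ.toStage9Params P (gOfRecord₁₃ F N θ.toStage13Params P) j s' U V'| * M j s'.init U) V'
          ≤ M (j + 1) s' V') :
    ∀ (s : SeqOfRecord F θ.ν θ.τ9.M (gOfRecord₁₃ F N θ.toStage13Params P) P.K k) U,
      |chiSeqOfRecord F N θ.ν θ.τ9.M (gOfRecord₁₃ F N θ.toStage13Params P) P.K k s U *
        slotsOfRecord F N θ.ν θ.τ9 (EOfRecord₁₃ F N θ.toStage13Params) (wOfRecord₉ F N θ.toStage9Params) θ.ppSel P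
          (gOfRecord₁₃ F N θ.toStage13Params P) k s U| ≤ M k s U :=
  by
  have hw : ∀ j, j < k → ∀ (s' : SeqOfRecord F θ.ν θ.τ9.M (gOfRecord₁₃ F N θ.toStage13Params P) P.K (j + 1))
      (V' : GaugeField (F.P P.K) (j + 1) (SU N)),
      Measurable fun U : GaugeField (F.P P.K) j (SU N) =>
        wOfRecord₉ F N θ.toStage9Params P (gOfRecord₁₃ F N θ.toStage13Params P) j s' U V' := by
    intro j hj s' V'
    have hjK : j < P.K := lt_of_lt_of_le hj hk
    -- joint measurability in `(V′, U)` (def-T's row `measW`) restricted to the section `V′`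
    exact Measurable.of_uncurry_left
      (f := fun (V'' : GaugeField (F.P P.K) (j + 1) (SU N)) (U : GaugeField (F.P P.K) j (SU N)) =>
        wOfRecord₉ F N θ.toStage9Params P (gOfRecord₁₃ F N θ.toStage13Params P) j s' U V'')
      ((h.tstep P j hjK).measW s')
  have hwb : ∀ j, j < k → ∀ (s' : SeqOfRecord F θ.ν θ.τ9.M (gOfRecord₁₃ F N θ.toStage13Params P) P.K (j + 1)) U
      (V' : GaugeField (F.P P.K) (j + 1) (SU N)),
      |wOfRecord₉ F N θ.toStage9Params P (gOfRecord₁₃ F N θ.toStage13Params P) j s' U V'| ≤ 1 := by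
    intro j hj s' U V'
    have hjK : j < P.K := lt_of_lt_of_le hj hk
    exact (h.tstep P j hjK).absW_le s' U V'
  exact abs_histTerm_le_of_majorantTower F N θ.ν θ.τ9 (EOfRecord₁₃ F N θ.toStage13Params) (wOfRecord₉ F N θ.toStage9Params) θ.ppSel P
    (gOfRecord₁₃ F N θ.toStage13Params P) k M cR h0 hMm hMC hw hwb hcR hR hstep

open Classical in
/-- **★★★ F2's PER-HISTORY BINDER `hU1π` FROM PER-STEP ROWS IN THE PRODUCT SHAPE** (the k → k+1 carving of (U1), sup currency): with `M_j(s) := e^{a_j}·Π_{i=1}^{j} x_i^{#𝐃_i-cubes ⊄ Ω_i(s)}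
y_i^{#𝐃_i-cubes ⊄ Λ_i(s)}` (`x, y ≥ 0`; field-independent, so measurable and bounded), the base is `−E(P) ≤ a_0` (`rhoZeroOfRecord_le`) and the step rows read, per new history `s′` and
coarse field `V′`, «`χ_{j+1}(s′)(V′) · c_R(s′) · T_j(|w_j(s′)(·,V′)|)(V′) · e^{a_j} ≤ e^{a_{j+1}} · x_{j+1}^{#⊄Ω_{j+1}(s′)} · y_{j+1}^{#⊄Λ_{j+1}(s′)}`» (the transported step weight × 𝐑-ratio modulus
must pay the new step's volume rate `a_{j+1} − a_j` and small factors; `init s′` keeps `Ω_i, Λ_i`, `i ≤ j`, `Seq.init_Ω ∕ init_Λ`); CONCLUSION = `…N13Cor3HistoryCountAtRecord13CoPH.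
densOfRecord₁₃_le_of_historyBound`'s hypothesis `hU1π` at level `k ≤ K`, verbatim.  HONEST: in print the factor per new large-field cube comes from `e^{A_j}` on that cube ((2.49)'s first term),
i.e. through a field-dependent `M_j` (use `abs_histTerm₁₃_le_of_majorantTower`); here `x_{j+1} = y_{j+1} = 1` is the plain instance.  CONDITIONAL on the displayed rows; nothing of Bałaban's
asserted. [cite: Balaban1988Convergent, (2.49) + Cor. 3 p.264, (3.25) p.270; Balaban1989LargeFieldI, (0.3) p.176; Balaban1989LargeFieldII, (1.89) p.387] -/
theorem histBound₁₃_of_productStepRows (h : θ.Provisos₁₃CoPH F N) (k : ℕ) (hk : k ≤ P.K) {x y : ℕ → ℝ} (hx : ∀ j, 0 ≤ x j) (hy : ∀ j, 0 ≤ y j)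
    (a : ℕ → ℝ) (cR : (j : ℕ) → SeqOfRecord F θ.ν θ.τ9.M (gOfRecord₁₃ F N θ.toStage13Params P) P.K j → GaugeField (F.P P.K) j (SU N) → ℝ)
    (h0 : -EOfRecord₁₃ F N θ.toStage13Params P ≤ a 0)
    (hcR : ∀ j, j < k → ∀ (s' : SeqOfRecord F θ.ν θ.τ9.M (gOfRecord₁₃ F N θ.toStage13Params P) P.K (j + 1)) V', 0 ≤ cR (j + 1) s' V')
    (hR : ∀ j, j < k → ∀ (s' : SeqOfRecord F θ.ν θ.τ9.M (gOfRecord₁₃ F N θ.toStage13Params P) P.K (j + 1)) V',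
      |slotsOfRecord F N θ.ν θ.τ9 (EOfRecord₁₃ F N θ.toStage13Params) (wOfRecord₉ F N θ.toStage9Params) θ.ppSel P
          (gOfRecord₁₃ F N θ.toStage13Params P) (j + 1) s' V'| ≤
        cR (j + 1) s' V' * |slotsTOfRecord F N θ.ν θ.τ9 (EOfRecord₁₃ F N θ.toStage13Params) (wOfRecord₉ F N θ.toStage9Params) θ.ppSel P
          (gOfRecord₁₃ F N θ.toStage13Params P) (j + 1) s' V'|)
    (hstep : ∀ j, j < k → ∀ (s' : SeqOfRecord F θ.ν θ.τ9.M (gOfRecord₁₃ F N θ.toStage13Params P) P.K (j + 1)) V',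
      chiSeqOfRecord F N θ.ν θ.τ9.M (gOfRecord₁₃ F N θ.toStage13Params P) P.K (j + 1) s' V' * cR (j + 1) s' V' *
          transportOfRecord F N P.K j (fun U => |wOfRecord₉ F N θ.toStage9Params P (gOfRecord₁₃ F N θ.toStage13Params P) j s' U V'|) V' *
          Real.exp (a j) ≤
        Real.exp (a (j + 1)) *
          (x (j + 1) ^ Set.ncard {c | c ∈ cubeIndices (F.P P.K) (dCubeSide (F.P P.K).L θ.τ9.M
              (RkOfRecord (F.P P.K).L θ.ν.r (gOfRecord₁₃ F N θ.toStage13Params P (j + 1))) (j + 1)) ∧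
            ¬ cubeEnl (F.P P.K) (dCubeSide (F.P P.K).L θ.τ9.M (RkOfRecord (F.P P.K).L θ.ν.r (gOfRecord₁₃ F N θ.toStage13Params P (j + 1))) (j + 1)) c 0 ⊆ s'.Ω (j + 1)} *
           y (j + 1) ^ Set.ncard {c | c ∈ cubeIndices (F.P P.K) (dCubeSide (F.P P.K).L θ.τ9.M
              (RkOfRecord (F.P P.K).L θ.ν.r (gOfRecord₁₃ F N θ.toStage13Params P (j + 1))) (j + 1)) ∧
            ¬ cubeEnl (F.P P.K) (dCubeSide (F.P P.K).L θ.τ9.M (RkOfRecord (F.P P.K).L θ.ν.r (gOfRecord₁₃ F N θ.toStage13Params P (j + 1))) (j + 1)) c 0 ⊆ s'.Λ (j + 1)})) :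
    ∀ (s : SeqOfRecord F θ.ν θ.τ9.M (gOfRecord₁₃ F N θ.toStage13Params P) P.K k) (V : GaugeField (F.P P.K) k (SU N)),
      (reprOfRecord₁₃ F N θ.toStage13Params P k).χ s V * (reprOfRecord₁₃ F N θ.toStage13Params P k).TexpA s V ≤
        Real.exp (a k) * ∏ j ∈ Finset.Icc 1 k,
          (x j ^ Set.ncard {c | c ∈ cubeIndices (F.P P.K) (dCubeSide (F.P P.K).L θ.τ9.M
              (RkOfRecord (F.P P.K).L θ.ν.r (gOfRecord₁₃ F N θ.toStage13Params P j)) j) ∧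
            ¬ cubeEnl (F.P P.K) (dCubeSide (F.P P.K).L θ.τ9.M (RkOfRecord (F.P P.K).L θ.ν.r (gOfRecord₁₃ F N θ.toStage13Params P j)) j) c 0 ⊆ s.Ω j} *
           y j ^ Set.ncard {c | c ∈ cubeIndices (F.P P.K) (dCubeSide (F.P P.K).L θ.τ9.M
              (RkOfRecord (F.P P.K).L θ.ν.r (gOfRecord₁₃ F N θ.toStage13Params P j)) j) ∧
            ¬ cubeEnl (F.P P.K) (dCubeSide (F.P P.K).L θ.τ9.M (RkOfRecord (F.P P.K).L θ.ν.r (gOfRecord₁₃ F N θ.toStage13Params P j)) j) c 0 ⊆ s.Λ j}) := by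
  -- the product-shape majorant family (field-independent)
  set Mf : (j : ℕ) → SeqOfRecord F θ.ν θ.τ9.M (gOfRecord₁₃ F N θ.toStage13Params P) P.K j → ℝ := fun j s =>
    Real.exp (a j) * ∏ i ∈ Finset.Icc 1 j,
          (x i ^ Set.ncard {c | c ∈ cubeIndices (F.P P.K) (dCubeSide (F.P P.K).L θ.τ9.M
              (RkOfRecord (F.P P.K).L θ.ν.r (gOfRecord₁₃ F N θ.toStage13Params P i)) i) ∧
            ¬ cubeEnl (F.P P.K) (dCubeSide (F.P P.K).L θ.τ9.M (RkOfRecord (F.P P.K).L θ.ν.r (gOfRecord₁₃ F N θ.toStage13Params P i)) i) c 0 ⊆ s.Ω i} *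
           y i ^ Set.ncard {c | c ∈ cubeIndices (F.P P.K) (dCubeSide (F.P P.K).L θ.τ9.M
              (RkOfRecord (F.P P.K).L θ.ν.r (gOfRecord₁₃ F N θ.toStage13Params P i)) i) ∧
            ¬ cubeEnl (F.P P.K) (dCubeSide (F.P P.K).L θ.τ9.M (RkOfRecord (F.P P.K).L θ.ν.r (gOfRecord₁₃ F N θ.toStage13Params P i)) i) c 0 ⊆ s.Λ i}) with hMf
  have hMf0 : ∀ j s, 0 ≤ Mf j s := fun j s => by
    rw [hMf]
    exact mul_nonneg (Real.exp_pos _).le (Finset.prod_nonneg fun i _ => mul_nonneg (pow_nonneg (hx i) _) (pow_nonneg (hy i) _))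
  intro s V
  change chiSeqOfRecord F N θ.ν θ.τ9.M (gOfRecord₁₃ F N θ.toStage13Params P) P.K k s V *
      slotsOfRecord F N θ.ν θ.τ9 (EOfRecord₁₃ F N θ.toStage13Params) (wOfRecord₉ F N θ.toStage9Params) θ.ppSel P
        (gOfRecord₁₃ F N θ.toStage13Params P) k s V ≤ Mf k s
  have key := abs_histTerm₁₃_le_of_majorantTower F N θ P h k hk (fun j s _ => Mf j s) cR ?_ (fun j _ s => measurable_const)
    (fun j _ s => ⟨Mf j s, fun _ => le_rfl⟩) hcR hR ?_ s V
  · exact (le_abs_self _).trans key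
  · -- base: `ρ₀ ≤ e^{−E} ≤ e^{a 0} = M_0`
    intro s U
    refine (rhoZeroOfRecord_le F N P.K _ _ U).trans ?_
    rw [hMf]
    simp only [show Finset.Icc 1 0 = ∅ from Finset.Icc_eq_empty (by omega), Finset.prod_empty, mul_one]
    exact Real.exp_le_exp.mpr h0
  · -- step: homogeneity of the transport + `init` keeps the first `j` pairs + the displayed product row
    intro j hj s' V'
    have hprod : ∏ i ∈ Finset.Icc 1 j,
          (x i ^ Set.ncard {c | c ∈ cubeIndices (F.P P.K) (dCubeSide (F.P P.K).L θ.τ9.M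
              (RkOfRecord (F.P P.K).L θ.ν.r (gOfRecord₁₃ F N θ.toStage13Params P i)) i) ∧
            ¬ cubeEnl (F.P P.K) (dCubeSide (F.P P.K).L θ.τ9.M (RkOfRecord (F.P P.K).L θ.ν.r (gOfRecord₁₃ F N θ.toStage13Params P i)) i) c 0 ⊆ s'.init.Ω i} *
           y i ^ Set.ncard {c | c ∈ cubeIndices (F.P P.K) (dCubeSide (F.P P.K).L θ.τ9.M
              (RkOfRecord (F.P P.K).L θ.ν.r (gOfRecord₁₃ F N θ.toStage13Params P i)) i) ∧
            ¬ cubeEnl (F.P P.K) (dCubeSide (F.P P.K).L θ.τ9.M (RkOfRecord (F.P P.K).L θ.ν.r (gOfRecord₁₃ F N θ.toStage13Params P i)) i) c 0 ⊆ s'.init.Λ i})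
        = ∏ i ∈ Finset.Icc 1 j,
          (x i ^ Set.ncard {c | c ∈ cubeIndices (F.P P.K) (dCubeSide (F.P P.K).L θ.τ9.M
              (RkOfRecord (F.P P.K).L θ.ν.r (gOfRecord₁₃ F N θ.toStage13Params P i)) i) ∧
            ¬ cubeEnl (F.P P.K) (dCubeSide (F.P P.K).L θ.τ9.M (RkOfRecord (F.P P.K).L θ.ν.r (gOfRecord₁₃ F N θ.toStage13Params P i)) i) c 0 ⊆ s'.Ω i} *
           y i ^ Set.ncard {c | c ∈ cubeIndices (F.P P.K) (dCubeSide (F.P P.K).L θ.τ9.M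
              (RkOfRecord (F.P P.K).L θ.ν.r (gOfRecord₁₃ F N θ.toStage13Params P i)) i) ∧
            ¬ cubeEnl (F.P P.K) (dCubeSide (F.P P.K).L θ.τ9.M (RkOfRecord (F.P P.K).L θ.ν.r (gOfRecord₁₃ F N θ.toStage13Params P i)) i) c 0 ⊆ s'.Λ i}) := by
      refine Finset.prod_congr rfl fun i hi => ?_
      rw [Finset.mem_Icc] at hi
      rw [Seq.init_Ω s' hi.1 hi.2, Seq.init_Λ s' hi.1 hi.2]
    have hP0 : 0 ≤ ∏ i ∈ Finset.Icc 1 j,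
          (x i ^ Set.ncard {c | c ∈ cubeIndices (F.P P.K) (dCubeSide (F.P P.K).L θ.τ9.M
              (RkOfRecord (F.P P.K).L θ.ν.r (gOfRecord₁₃ F N θ.toStage13Params P i)) i) ∧
            ¬ cubeEnl (F.P P.K) (dCubeSide (F.P P.K).L θ.τ9.M (RkOfRecord (F.P P.K).L θ.ν.r (gOfRecord₁₃ F N θ.toStage13Params P i)) i) c 0 ⊆ s'.Ω i} *
           y i ^ Set.ncard {c | c ∈ cubeIndices (F.P P.K) (dCubeSide (F.P P.K).L θ.τ9.M
              (RkOfRecord (F.P P.K).L θ.ν.r (gOfRecord₁₃ F N θ.toStage13Params P i)) i) ∧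
            ¬ cubeEnl (F.P P.K) (dCubeSide (F.P P.K).L θ.τ9.M (RkOfRecord (F.P P.K).L θ.ν.r (gOfRecord₁₃ F N θ.toStage13Params P i)) i) c 0 ⊆ s'.Λ i}) :=
      Finset.prod_nonneg fun i _ => mul_nonneg (pow_nonneg (hx i) _) (pow_nonneg (hy i) _)
    have hrow := hstep j hj s' V'
    -- rewrite the transported majorant: `T(|w|·M_j(init s′)) = M_j(init s′)·T(|w|)`
    have hT : transportOfRecord F N P.K j
          (fun U => |wOfRecord₉ F N θ.toStage9Params P (gOfRecord₁₃ F N θ.toStage13Params P) j s' U V'| * Mf j s'.init) V'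
        = Mf j s'.init * transportOfRecord F N P.K j
          (fun U => |wOfRecord₉ F N θ.toStage9Params P (gOfRecord₁₃ F N θ.toStage13Params P) j s' U V'|) V' := by
      rw [← transportOfRecord_const_mul]
      refine congrArg (fun f => transportOfRecord F N P.K j f V') (funext fun U => ?_)
      ring
    rw [hT, hMf]
    simp only
    rw [hprod, Finset.prod_Icc_succ_top (by omega : 1 ≤ j + 1)]
    -- goal: χ·cR·(e^{a j}·Π_j · T|w|) ≤ e^{a(j+1)}·(Π_j · new factor)
    have := mul_le_mul_of_nonneg_right hrow hP0
    nlinarith [this, hP0]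

open Classical in
/-- **★★★ THE UPPER HALF OF (0.1) AT K1⁷'s RECORD FROM PER-STEP ROWS** (the k → k+1 carving COMPOSED with F2's count): for `k ≤ K`, from the 𝐑-ratio rows, the product-shape step rows
(`histBound₁₃_of_productStepRows`) and the numeric clause `a_k + Σ_{j=1}^{k} (x_j + y_j)|I_j| ≤ E₊|T₁^{(k)}|` (F2's located demand: `|I_j| ≈ L^{4(k−j)}|T₁^{(k)}|∕(M R_j)⁴`), conclude
`ρ_k(V) ≤ exp(E₊|T₁^{(k)}|)` at every configuration (`densOfRecord₁₃_le_of_historyBound`).  CONDITIONAL on the displayed rows; (U1) NOT proved; nothing of Bałaban's asserted. [cite: Balaban1988Convergent, Cor. 3 (2.50) p.264; Balaban1989LargeFieldI, (0.2)–(0.3) p.176; Balaban1989LargeFieldII, (0.1) pp.355–356] -/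
theorem densOfRecord₁₃_le_of_productStepRows (h : θ.Provisos₁₃CoPH F N) (k : ℕ) (hk : k ≤ P.K) {x y : ℕ → ℝ} (hx : ∀ j, 0 ≤ x j) (hy : ∀ j, 0 ≤ y j)
    (a : ℕ → ℝ) (Ep : ℝ) (cR : (j : ℕ) → SeqOfRecord F θ.ν θ.τ9.M (gOfRecord₁₃ F N θ.toStage13Params P) P.K j → GaugeField (F.P P.K) j (SU N) → ℝ)
    (h0 : -EOfRecord₁₃ F N θ.toStage13Params P ≤ a 0)
    (hcR : ∀ j, j < k → ∀ (s' : SeqOfRecord F θ.ν θ.τ9.M (gOfRecord₁₃ F N θ.toStage13Params P) P.K (j + 1)) V', 0 ≤ cR (j + 1) s' V')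
    (hR : ∀ j, j < k → ∀ (s' : SeqOfRecord F θ.ν θ.τ9.M (gOfRecord₁₃ F N θ.toStage13Params P) P.K (j + 1)) V',
      |slotsOfRecord F N θ.ν θ.τ9 (EOfRecord₁₃ F N θ.toStage13Params) (wOfRecord₉ F N θ.toStage9Params) θ.ppSel P
          (gOfRecord₁₃ F N θ.toStage13Params P) (j + 1) s' V'| ≤
        cR (j + 1) s' V' * |slotsTOfRecord F N θ.ν θ.τ9 (EOfRecord₁₃ F N θ.toStage13Params) (wOfRecord₉ F N θ.toStage9Params) θ.ppSel P
          (gOfRecord₁₃ F N θ.toStage13Params P) (j + 1) s' V'|)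
    (hstep : ∀ j, j < k → ∀ (s' : SeqOfRecord F θ.ν θ.τ9.M (gOfRecord₁₃ F N θ.toStage13Params P) P.K (j + 1)) V',
      chiSeqOfRecord F N θ.ν θ.τ9.M (gOfRecord₁₃ F N θ.toStage13Params P) P.K (j + 1) s' V' * cR (j + 1) s' V' *
          transportOfRecord F N P.K j (fun U => |wOfRecord₉ F N θ.toStage9Params P (gOfRecord₁₃ F N θ.toStage13Params P) j s' U V'|) V' *
          Real.exp (a j) ≤
        Real.exp (a (j + 1)) *
          (x (j + 1) ^ Set.ncard {c | c ∈ cubeIndices (F.P P.K) (dCubeSide (F.P P.K).L θ.τ9.M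
              (RkOfRecord (F.P P.K).L θ.ν.r (gOfRecord₁₃ F N θ.toStage13Params P (j + 1))) (j + 1)) ∧
            ¬ cubeEnl (F.P P.K) (dCubeSide (F.P P.K).L θ.τ9.M (RkOfRecord (F.P P.K).L θ.ν.r (gOfRecord₁₃ F N θ.toStage13Params P (j + 1))) (j + 1)) c 0 ⊆ s'.Ω (j + 1)} *
           y (j + 1) ^ Set.ncard {c | c ∈ cubeIndices (F.P P.K) (dCubeSide (F.P P.K).L θ.τ9.M
              (RkOfRecord (F.P P.K).L θ.ν.r (gOfRecord₁₃ F N θ.toStage13Params P (j + 1))) (j + 1)) ∧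
            ¬ cubeEnl (F.P P.K) (dCubeSide (F.P P.K).L θ.τ9.M (RkOfRecord (F.P P.K).L θ.ν.r (gOfRecord₁₃ F N θ.toStage13Params P (j + 1))) (j + 1)) c 0 ⊆ s'.Λ (j + 1)}))
    (hnum : a k + ∑ j ∈ Finset.Icc 1 k, (x j + y j) *
          (cubeIndices (F.P P.K) (dCubeSide (F.P P.K).L θ.τ9.M (RkOfRecord (F.P P.K).L θ.ν.r (gOfRecord₁₃ F N θ.toStage13Params P j)) j)).card
        ≤ Ep * (Fintype.card (Site (F.P P.K) k) : ℝ)) :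
    ∀ V : GaugeField (F.P P.K) k (SU N), densOfRecord₁₃ F N θ.toStage13Params P k V ≤ Real.exp (Ep * (Fintype.card (Site (F.P P.K) k) : ℝ)) :=
  densOfRecord₁₃_le_of_historyBound F N θ P k hx hy (a k) Ep
    (histBound₁₃_of_productStepRows F N θ P h k hk hx hy a cR h0 hcR hR hstep) hnum

end AtRecord

end Summit.QuantumFields.YangMills.BalabanUVNodes.N13U1StepMajorantTowerAtRecord13CoPH

end
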